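import Summits.Ventures.AbcSig.Rows.TemplateC2a
import Summits.Ventures.AbcSig.Levels.N622
import Summits.Ventures.AbcSig.Levels.N9952

/-!
# Venture AbcSig — ROW `C2aL311A3`: `xⁿ + 2^a·311^m·yⁿ = z²`, class `a 3` (GENERATED by plean/leanrow.py)

HONEST FRAMING. A row of a COMPUTATION cell (`pub-abcsig`); a CONDITIONAL theorem, no claim on ABC or any summit.
Hypotheses: `BS04Package` (CITED), `DataComplete` at levels [622, 9952] (COMPUTED, two-engine certified
level files), and the listed per-orbit exclusions `hX_…` (CITED; the
row's R5 cell names each). Everything else is kernel-checked (`Rows/TemplateC2a.lean`, `Levels/N….lean`). Exponent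
range: prime `n ≥ 11`, `n ≠ 311`, n ∉ [11]; `B = 2^a 311^m` with `a, m < n` (n-th-power free).
Row of record: `census/rows/C2a/C2a-l311-a3.md` (sha256 `ef402e2050646a3b…`; SIGNED 2026-08-22T17:51:55Z by referee (ref-g14)); its R0: THEOREM for primes n >= 11, n not in [11] (uses CITED facts); the survivors [11] need M4 (Kraus) / stay open — class: candidate (a ∈ {0,3} cell, BATCH-03; lit/C. Exponents left open by the row of record are excluded here via `hres`; kernel-sieve residuals the row of record closes by a cell module (M6 Eisenstein / M4 Kraus certificates) appear as CITED hypotheses `hX_…`.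
-/

namespace Summit.Ventures.AbcSig

/-- Row `C2aL311A3` (see module docstring). -/
theorem row_C2aL311A3 (M : NewformModel) (hP : M.BS04Package)
    (hD622 : M.DataComplete 622 level622Orbits) (hD9952 : M.DataComplete 9952 level9952Orbits)
    (n : ℕ) (hn : n.Prime) (hmin : 11 ≤ n) (hnℓ : n ≠ 311) (hres : n ∉ ([11] : List ℕ)) (m : ℕ) (hm : 1 ≤ m) (hmn : m < n)
    (hX_orbit_622_4 : n ∈ ([13] : List ℕ) → M.Excludes 622 orbit_622_4 (famB (2 ^ 3 * 311 ^ m) n (fun _ _ => True)))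
    (hX_orbit_9952_9 : n ∈ ([13] : List ℕ) → M.Excludes 9952 orbit_9952_9 (famB (2 ^ 3 * 311 ^ m) n (fun _ _ => True)))
    (hX_orbit_9952_10 : n ∈ ([13] : List ℕ) → M.Excludes 9952 orbit_9952_10 (famB (2 ^ 3 * 311 ^ m) n (fun _ _ => True)))
    (x y z : ℤ) (hxy1 : x * y ≠ 1) (hxy2 : x * y ≠ -1) : ¬ IsPrimitiveSolution 1 (2 ^ 3 * 311 ^ m) 1 n x y z := by
  have hℓ : Nat.Prime 311 := by norm_num
  have h7 : 7 ≤ n := by omega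
  have hS622 :=
    (level622_sieve n hn h7 (fun o => M.Excludes 622 o (famB (2 ^ 3 * 311 ^ m) n (fun _ _ => True))) (fun h => absurd h (by simp only [List.mem_cons, List.not_mem_nil, or_false] at hres ⊢; omega)) (fun h => absurd h (by simp only [List.mem_cons, List.not_mem_nil, or_false] at hres ⊢; omega)) hX_orbit_622_4)
  have hS9952 :=
    (level9952_sieve n hn h7 (fun o => M.Excludes 9952 o (famB (2 ^ 3 * 311 ^ m) n (fun _ _ => True))) (fun h => absurd h (by simp only [List.mem_cons, List.not_mem_nil, or_false] at hres ⊢; omega)) (fun h => absurd h (by simp only [List.mem_cons, List.not_mem_nil, or_false] at hres ⊢; omega)) (fun h => absurd h (by simp only [List.mem_cons, List.not_mem_nil, or_false] at hres ⊢; omega)) (fun h => absurd h (by simp only [List.mem_cons, List.not_mem_nil, or_false] at hres ⊢; omega)) hX_orbit_9952_9 hX_orbit_9952_10 (fun h => absurd h (by simp only [List.mem_cons, List.not_mem_nil, or_false] at hres ⊢; omega)) (fun h => absurd h (by simp only [List.mem_cons, List.not_mem_nil, or_false] at hres ⊢; omega)))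
  exact rowC2a_a3 311 hℓ (by norm_num) M hP n hn h7 hnℓ hD9952 hD622 m hm hmn
    hS9952
    hS622 x y z hxy1 hxy2

end Summit.Ventures.AbcSig
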